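import Summits.HodgeConjecture.CorCM.Census.CyclicCharacterEvenBalancedRelation

/-!
# Cyclic characters, XXXIX: EVEN KERNEL, `d = 0` — THE LOWER-RULED CERTIFICATE (`k = 2`): `β − 2` faces with the toward property, `ζ`, and `R(B')`

COR-CM (cell `pub-hodgecm2`), count-neutral kernel combinatorics by the binder seat b09 (gen 44; lane CYCLIC-CHARACTER FIBRE LAW, part XXXIX), on parts
XXXIV–XXXVIII, gen 43ʼs even three-across (`Census/CyclicCharacterEvenEquator.zeta_mem_of_threeAcross_even_up`), adjacent ties
(`Census/CyclicCharacterEvenTiePairs.exists_adjacent_tie_blk_ne`), near blocks (`Census/CyclicCharacterEvenNearBlocks`), gen 38/39ʼs covering on a set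
(`Census/BaseBlockCoveringOn`) and lit-andre-3ʼs fixed types (`Census/TypeStabiliserSubgroup.exists_rt_eq_of_notMem_zpowers`) BY NAME.  Theorems only (no
definition, no `decide` beyond numerals of `ℤ/4`, no certificate data, no named fact, no `sorry`).  HONEST FRAMING: `HC_CM` is NOT proved, here or anywhere in
the tree; nothing here is a period or a headline.

**THE CERTIFICATE (`exists_nonrootCert`).**  `G` finite, `c` a central involution, `w : G ↠ ℤ/4` additive with `w c ≠ 0`, kernel of even size `2m ≥ 4`, and
`d = 0` (some `g` with `w g` odd has `c ∉ ⟨g⟩`).  There is a face family `S₀` with `|S₀| + 2 ≤ β(G, c)` (`= φ₂ + 2`) such that `L = ℤ⟨pairs⟩ + ℤ[G]·S₀`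
(i) has the toward property through every type of potential `≥ 2`, (ii) contains `ζ_t` for a bottom point `t`, and (iii) contains the relation `R(B')` for a
set `B'` of bottom points.  CONSTRUCTION: `Ψ` a type fixed by a non-root `g` with `w g = 1` (balanced, potential `n`), `B = F_0 ∖ Ψ`, `X_B` the pure tie below it,
`X'' = X_B^{(b)(v)}` an adjacent tie in another block (gen 43); `S₀` = gen 38ʼs cover of the far blocks that are neither two-way ties nor the block of `Ψ`
+ the LOWER-RULED family on the two-way tie blocks other than `E = blk X''` (part XXXVI) + the explicit UP face `gface X'' u u'` + the owned face
`gface Ψ s t'` + the even three-across face `gface X_B^{(b)} b v`.  Then (i) by transport of the explicit faces; (ii) by gen 43ʼs three-across with `X_B` DOWN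
(canonically, part XXXV) and `X''` UP; (iii) by part XXXVIII.  Part XL reads off the law `μ = φ₂ = β − 2`.

## References
* [Pohlmann1968] H. Pohlmann, Algebraic cycles on abelian varieties of complex multiplication type, Ann. of Math. 88 (1968), Thm 1.
-/

namespace Summit.HodgeConjecture.CorCM.Census.CyclicCharacter

open Finset
open Summit.HodgeConjecture.CorCM.Prior.AllgGroup.RfwfAllgGroup
open Summit.HodgeConjecture.CorCM.Census.BlockParity
open Summit.HodgeConjecture.CorCM.Census.Coinvariant
open Summit.HodgeConjecture.CorCM.Census.TwistGeneration
open Summit.HodgeConjecture.CorCM.Census.BaseBlock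
open Summit.HodgeConjecture.CorCM.Census.TypeStabiliser

noncomputable section

variable {G : Type*} [Group G] [Fintype G] [DecidableEq G] {k : ℕ} {w : G → ZMod (2 ^ k)} {c : G}

/-! ## §1 The excluded block does not meet the sub-lattice of the balanced type -/

/-- **A pure bottom tieʼs block meets the lower-left sub-lattice of `Ψ` only in `X_B`**: if `T_0 ∖ X'' ⊆ F_0` has `m` points, `T_0 ∖ Z ⊆ T_0 ∖ Ψ` with
`x_0(Z) = m = x_0(Ψ) = x_1(Ψ)`, and `Z` lies in the block of `X''`, then `T_0 ∖ Z = F_0 ∖ Ψ` (`k = 2`, `n = 2m ≥ 2`). [folklore] -/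
theorem sdiff_eq_of_blk_eq_pureTie (hw : ∀ P Q : G, w (P * Q) = w P + w Q) (hk : 1 ≤ k) (hk2 : k = 2) (hc2 : c * c = 1) (hwc : w c ≠ 0)
    (h1 : ∃ g₁ : G, w g₁ = 1) {m : ℕ} (hm : 2 * m = (univ.filter fun s : G => w s = 0).card) (hm1 : 1 ≤ m)
    {X'' Ψ Z : CMF G c} (hX''F : (arcType hw hk hc2 hwc 0).1 \ X''.1 ⊆ univ.filter fun s : G => w s = 0)
    (hX''m : ((arcType hw hk hc2 hwc 0).1 \ X''.1).card = m)
    (hΨ0 : ((univ.filter fun s : G => w s = 0) \ Ψ.1).card = m) (hΨ1 : ((univ.filter fun s : G => w s = 1) \ Ψ.1).card = m)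
    (hZ : (arcType hw hk hc2 hwc 0).1 \ Z.1 ⊆ (arcType hw hk hc2 hwc 0).1 \ Ψ.1) (hZ0 : ((univ.filter fun s : G => w s = 0) \ Z.1).card = m)
    (hblk : blk c Z = blk c X'') : (arcType hw hk hc2 hwc 0).1 \ Z.1 = (univ.filter fun s : G => w s = 0) \ Ψ.1 := by
  haveI : Fact (1 < 2 ^ k) := ⟨Nat.one_lt_two_pow (by omega)⟩
  obtain ⟨P, hP⟩ := exists_rt_eq_of_blk_eq c hblk.symm
  -- coordinates of `X''`: `(m, 0, n − m, n)`
  have hx0 : ((univ.filter fun s : G => w s = 0) \ X''.1).card = m := by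
    rw [fib_zero_sdiff_eq_filter hw hk hk2 hc2 hwc, filter_true_of_mem fun x hx => (mem_filter.mp (hX''F hx)).2, hX''m]
  have hx1 : ((univ.filter fun s : G => w s = 1) \ X''.1).card = 0 := by
    rw [fib_one_sdiff_eq_filter hw hk hk2 hc2 hwc, card_eq_zero, filter_eq_empty_iff]
    intro x hx h; have := (mem_filter.mp (hX''F hx)).2; rw [this] at h; exact one_ne_zero h.symm
  have s0 := card_fib_sdiff_add hw hk hk2 hc2 hwc h1 X'' 0
  have s1 := card_fib_sdiff_add hw hk hk2 hc2 hwc h1 X'' 1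
  rw [zero_add] at s0; rw [show (1 : ZMod (2 ^ k)) + 2 = 3 by subst hk2; decide] at s1
  -- coordinates of `Z = X''·P⁻¹`
  have hz : ∀ j : ZMod (2 ^ k), ((univ.filter fun s : G => w s = j) \ Z.1).card = ((univ.filter fun s : G => w s = j + w P) \ X''.1).card :=
    fun j => by rw [← hP, card_fib_sdiff_rt hw]
  have hZ1 : ((univ.filter fun s : G => w s = 1) \ Z.1).card ≤ m := by
    have := (card_fib_sdiff_le_of_sdiff_subset hw hk hk2 hc2 hwc hZ).2; omega
  -- `w P = 0`
  have hP0 : w P = 0 := by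
    rcases eq_zero_or_one_or_two_or_three hk2 (w P) with h | h | h | h
    · exact h
    · exfalso; have := hz 0; rw [h, zero_add, hZ0, hx1] at this; omega
    · exfalso; have := hz 1; rw [h, show (1 : ZMod (2 ^ k)) + 2 = 3 by subst hk2; decide] at this; omega
    · exfalso; have := hz 0; rw [h, zero_add, hZ0] at this; omega
  -- so `x_1(Z) = 0`: the deviation of `Z` is bottom, inside `F_0 ∖ Ψ`, of full size
  have hZ1' : ((univ.filter fun s : G => w s = 1) \ Z.1).card = 0 := by have := hz 1; rw [hP0, add_zero, hx1] at this; exact this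
  have hsub : (arcType hw hk hc2 hwc 0).1 \ Z.1 ⊆ (univ.filter fun s : G => w s = 0) \ Ψ.1 := by
    intro x hx
    have hxT := hZ hx
    rcases (mem_arcType_iff_of_two hw hk hk2 hc2 hwc 0 x).mp (mem_sdiff.mp hx).1 with h0 | h01
    · exact mem_sdiff.mpr ⟨mem_filter.mpr ⟨mem_univ _, h0⟩, (mem_sdiff.mp hxT).2⟩
    · exfalso
      rw [zero_add] at h01
      rw [card_eq_zero] at hZ1'
      have : x ∈ (univ.filter fun s : G => w s = 1) \ Z.1 := mem_sdiff.mpr ⟨mem_filter.mpr ⟨mem_univ _, h01⟩, (mem_sdiff.mp hx).2⟩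
      rw [hZ1'] at this; exact notMem_empty x this
  refine eq_of_subset_of_card_le hsub ?_
  obtain ⟨e0, -, -, -⟩ := ddist_arcType_four hw hk hk2 hc2 hwc h1 Z
  unfold ddist at e0
  omega

/-! ## §2 The certificate -/

/-- **THE LOWER-RULED CERTIFICATE for `d = 0`, `k = 2`** (see the file header). [folklore] -/
theorem exists_nonrootCert [Fintype (CMF G c)] (hw : ∀ P Q : G, w (P * Q) = w P + w Q) (hk : 1 ≤ k) (hk2 : k = 2)
    (hc2 : c * c = 1) (hcen : ∀ x : G, x * c = c * x) (hwc : w c ≠ 0) (h1 : ∃ g₁ : G, w g₁ = 1)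
    (hnon : ∃ g : G, ¬ 2 ∣ (w g).val ∧ c ∉ Subgroup.zpowers g)
    {m : ℕ} (hm : 2 * m = (univ.filter fun s : G => w s = 0).card) (hm2 : 2 ≤ m) :
    ∃ S₀ : Finset (CMF G c →₀ ℤ), (↑S₀ ⊆ gfaceSet G c hc2) ∧ S₀.card + 2 ≤ Fintype.card (Block c) ∧
      (∀ Φ : CMF G c, 2 ≤ bpot c (arcType hw hk hc2 hwc 0) Φ → ∃ Q s s' : G,
        bpot c (arcType hw hk hc2 hwc 0) Φ = ddist (rt c Q (arcType hw hk hc2 hwc 0)) Φ ∧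
          s ∈ (rt c Q (arcType hw hk hc2 hwc 0)).1 \ Φ.1 ∧ s' ∈ (rt c Q (arcType hw hk hc2 hwc 0)).1 \ Φ.1 ∧ s ≠ s' ∧
            gface c hc2 Φ s s' ∈ Submodule.span ℤ (pairSet c) ⊔ Submodule.span ℤ (translates c S₀)) ∧
      (∃ t : G, w t = 0 ∧
        (Finsupp.single (oflipCM c hc2 t (arcType hw hk hc2 hwc 0)) (1 : ℤ) - Finsupp.single (arcType hw hk hc2 hwc 0) 1) +
          (Finsupp.single (oflipCM c hc2 t (arcType hw hk hc2 hwc 1)) (1 : ℤ) - Finsupp.single (arcType hw hk hc2 hwc 1) 1) ∈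
            Submodule.span ℤ (pairSet c) ⊔ Submodule.span ℤ (translates c S₀)) ∧
      (∃ B' : Finset G, B' ⊆ (univ.filter fun s : G => w s = 0) ∧
        Finsupp.single (arcType hw hk hc2 hwc 0) (1 : ℤ) - Finsupp.single (arcType hw hk hc2 hwc 1) 1 +
            (∑ q ∈ B', (Finsupp.single (oflipCM c hc2 q (arcType hw hk hc2 hwc 0)) (1 : ℤ) - Finsupp.single (arcType hw hk hc2 hwc 0) 1)) -
            (∑ q ∈ (univ.filter fun s : G => w s = 0) \ B',
              (Finsupp.single (oflipCM c hc2 q (arcType hw hk hc2 hwc 1)) (1 : ℤ) - Finsupp.single (arcType hw hk hc2 hwc 1) 1)) ∈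
          Submodule.span ℤ (pairSet c) ⊔ Submodule.span ℤ (translates c S₀)) := by
  classical
  have hk' : 2 ≤ k := by omega
  have hmn : m < (univ.filter fun s : G => w s = 0).card := by omega
  haveI : Fact (1 < 2 ^ k) := ⟨Nat.one_lt_two_pow (by omega)⟩
  obtain ⟨Qm, hQm⟩ := exists_apply_eq hw h1 (-1)
  have eT₁ : arcType hw hk hc2 hwc 1 = rt c Qm (arcType hw hk hc2 hwc 0) := arcType_eq_rt hw hk hc2 hwc hQm
  have hwc' : ∀ x : G, w x = 0 → ∀ y : G, w y = 0 → y ≠ c * x := fun x hx y hy h => hwc (by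
    have := congrArg w h; rw [hw, hx, hy, add_zero] at this; exact this.symm)
  have n12 : (1 : ZMod (2 ^ k)) + 1 = 2 := by subst hk2; decide
  -- the non-root, the balanced type, its bottom deviation `B = F_0 ∖ Ψ` and the pure tie `X = X_B`
  obtain ⟨g, hg, hgc⟩ := exists_apply_eq_one_notMem_zpowers hw hk2 hnon
  obtain ⟨Ψ, hΨ⟩ := exists_rt_eq_of_notMem_zpowers c hc2 hcen hgc
  obtain ⟨hBm, hVm, hpotΨ⟩ := balanced_of_rt_eq hw hk hk2 hc2 hwc h1 hm hΨ hg
  have hBF : (univ.filter fun s : G => w s = 0) \ Ψ.1 ⊆ univ.filter fun s : G => w s = 0 := sdiff_subset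
  have hB2 : 2 * ((univ.filter fun s : G => w s = 0) \ Ψ.1).card = (univ.filter fun s : G => w s = 0).card := by rw [hBm]; exact hm
  obtain ⟨X, hX⟩ := exists_sdiff_eq_of_subset_fibre hw hk hc2 hwc _ hBF
  obtain ⟨b, hb, v, hv, hblkne⟩ := exists_adjacent_tie_blk_ne hw hk hk' hc2 hwc h1 hBF hB2 (by omega) hX
  have hb0 : w b = 0 := (mem_filter.mp (hBF hb)).2
  have hv0 : w v = 0 := (mem_filter.mp (mem_sdiff.mp hv).1).2
  have hvB : v ∉ (univ.filter fun s : G => w s = 0) \ Ψ.1 := (mem_sdiff.mp hv).2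
  have hbv : b ≠ v := fun h => hvB (h ▸ hb)
  have hbT : b ∈ (arcType hw hk hc2 hwc 0).1 := (mem_arcType_zero_and_notMem_one hw hk hc2 hwc hb0).1
  have hbX : b ∉ X.1 := fun h => (mem_sdiff.mp (hX.symm ▸ hb : b ∈ (arcType hw hk hc2 hwc 0).1 \ X.1)).2 h
  have hX' : (arcType hw hk hc2 hwc 0).1 \ (oflipCM c hc2 b X).1 = ((univ.filter fun s : G => w s = 0) \ Ψ.1).erase b := by
    rw [dev_oflip c hc2 hbT hbX, hX]
  have hX'b : oflipCM c hc2 b (oflipCM c hc2 b X) = X := oflipCM_oflipCM_self c hc2 b X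
  have hX'' : (arcType hw hk hc2 hwc 0).1 \ (oflipCM c hc2 v (oflipCM c hc2 b X)).1 = insert v (((univ.filter fun s : G => w s = 0) \ Ψ.1).erase b) :=
    sdiff_oflipCM_eq_insert hw hk hc2 hwc hX' hv0 (fun h => hvB (mem_of_mem_erase h))
  have hCv : insert v (((univ.filter fun s : G => w s = 0) \ Ψ.1).erase b) ⊆ univ.filter fun s : G => w s = 0 :=
    insert_subset (mem_sdiff.mp hv).1 ((erase_subset b _).trans hBF)
  have hcv : (insert v (((univ.filter fun s : G => w s = 0) \ Ψ.1).erase b)).card = m := by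
    rw [card_insert_of_notMem (fun h => hvB (mem_of_mem_erase h)), card_erase_add_one hb, hBm]
  have h2X'' : 2 * ((arcType hw hk hc2 hwc 0).1 \ (oflipCM c hc2 v (oflipCM c hc2 b X)).1).card = (univ.filter fun s : G => w s = 0).card := by
    rw [hX'', hcv]; exact hm
  have hpotX'' : bpot c (arcType hw hk hc2 hwc 0) (oflipCM c hc2 v (oflipCM c hc2 b X)) = m := by
    rw [bpot_eq_of_tie hw hk hc2 hwc h2X'', hX'', hcv]
  have hne : blk c (oflipCM c hc2 v (oflipCM c hc2 b X)) ≠ blk c X := hblkne _ hX''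
  obtain ⟨E, hEdef⟩ : ∃ E : Block c, E = blk c (oflipCM c hc2 v (oflipCM c hc2 b X)) := ⟨_, rfl⟩
  have hT1X'' := sdiff_arcType_one_eq_image hw hk hc2 hwc (oflipCM c hc2 v (oflipCM c hc2 b X)) (hX''.symm ▸ hCv)
  rw [hX''] at hT1X''
  have hUc : ((univ.filter fun s : G => w s = 0) \ insert v (((univ.filter fun s : G => w s = 0) \ Ψ.1).erase b)).card = m := by
    have := card_sdiff_add_card_eq_card hCv; omega
  have hd1X'' : ddist (arcType hw hk hc2 hwc 1) (oflipCM c hc2 v (oflipCM c hc2 b X)) = m := by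
    unfold ddist; rw [hT1X'', card_image_of_injective _ (mul_right_injective c), hUc]
  -- the explicit UP face at `X''`
  obtain ⟨u, hu, u', hu', huu'⟩ := one_lt_card.mp (by omega : 1 < ((univ.filter fun s : G => w s = 0) \
    insert v (((univ.filter fun s : G => w s = 0) \ Ψ.1).erase b)).card)
  have hu0 : w u = 0 := (mem_filter.mp (mem_sdiff.mp hu).1).2
  have hu'0 : w u' = 0 := (mem_filter.mp (mem_sdiff.mp hu').1).2
  have hfUp : gface c hc2 (oflipCM c hc2 v (oflipCM c hc2 b X)) u u' ∈ gfaceSet G c hc2 :=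
    ⟨_, u, u', by rw [mem_orb]; push Not; exact ⟨huu'.symm, hwc' u hu0 u' hu'0⟩, rfl⟩
  have hfUpeq : gface c hc2 (oflipCM c hc2 v (oflipCM c hc2 b X)) u u' = gface c hc2 (oflipCM c hc2 v (oflipCM c hc2 b X)) (c * u) (c * u') := by
    simp only [gface, oflipCM_cmul]
  -- the owned face at `Ψ`: `t' ∈ F_1 ∖ Ψ`, `s ∈ F_0 ∩ Ψ`
  obtain ⟨t', ht'⟩ : (((univ.filter fun s : G => w s = 1) \ Ψ.1)).Nonempty := card_pos.mp (by omega)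
  have ht'1 : w t' = 1 := (mem_filter.mp (mem_sdiff.mp ht').1).2
  have ht'Ψ : t' ∉ Ψ.1 := (mem_sdiff.mp ht').2
  have hIc : ((univ.filter fun s : G => w s = 0) \ ((univ.filter fun s : G => w s = 0) \ Ψ.1)).card = m := by
    have := card_sdiff_add_card_eq_card hBF; omega
  obtain ⟨s, hs⟩ : ((univ.filter fun s : G => w s = 0) \ ((univ.filter fun s : G => w s = 0) \ Ψ.1)).Nonempty := card_pos.mp (by omega)
  have hs0 : w s = 0 := (mem_filter.mp (mem_sdiff.mp hs).1).2
  have hsΨ : s ∈ Ψ.1 := by by_contra h; exact (mem_sdiff.mp hs).2 (mem_sdiff.mpr ⟨(mem_sdiff.mp hs).1, h⟩)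
  have hcs2 : w (c * s) = 2 := by rw [hw, hs0, add_zero, apply_c_eq_two hw hk hk2 hc2 hwc]
  have hcsΨ : c * s ∉ Ψ.1 := fun h => ((cmul_mem_iff Ψ s).mp h) hsΨ
  have hfΨ : gface c hc2 Ψ s t' ∈ gfaceSet G c hc2 := by
    refine ⟨Ψ, s, t', ?_, rfl⟩
    rw [mem_orb]; push Not
    refine ⟨fun h => ?_, fun h => ?_⟩
    · have := congrArg w h; rw [ht'1, hs0] at this; exact one_ne_zero this
    · have := congrArg w h; rw [ht'1, hcs2] at this; revert this; subst hk2; decide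
  have hfΨeq : gface c hc2 Ψ s t' = gface c hc2 Ψ (c * s) t' := by simp only [gface, oflipCM_cmul]
  -- the three-across face
  have hf3 : gface c hc2 (oflipCM c hc2 b X) b v ∈ gfaceSet G c hc2 :=
    ⟨oflipCM c hc2 b X, b, v, by rw [mem_orb]; push Not; exact ⟨hbv.symm, hwc' b hb0 v hv0⟩, rfl⟩
  -- the tie predicate, the lower-ruled family, the cover of the remaining far blocks
  obtain ⟨tie, htie⟩ : ∃ tie : Block c → Prop, ∀ Bk : Block c, tie Bk ↔ (2 ≤ bpot c (arcType hw hk hc2 hwc 0) Bk.out ∧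
      bpot c (arcType hw hk hc2 hwc 0) Bk.out < (univ.filter fun s : G => w s = 0).card ∧
      ∃ Q Q' : G, w Q' + 1 = w Q ∧ bpot c (arcType hw hk hc2 hwc 0) Bk.out = ddist (rt c Q (arcType hw hk hc2 hwc 0)) Bk.out ∧
        bpot c (arcType hw hk hc2 hwc 0) Bk.out = ddist (rt c Q' (arcType hw hk hc2 hwc 0)) Bk.out) := ⟨_, fun Bk => Iff.rfl⟩
  haveI htiedec : DecidablePred tie := fun _ => Classical.propDecidable _
  obtain ⟨St, hStf, hStc, hSt⟩ := exists_lowerRuled hw hk hk2 hc2 hwc h1 tie htie E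
  obtain ⟨Sc, hScf, hScc, -, -, -, htwc⟩ := exists_joint_cover_on c (arcType hw hk hc2 hwc 0) hc2
    (fun Bk : Block c => 2 ≤ bpot c (arcType hw hk hc2 hwc 0) Bk.out ∧ ¬ tie Bk ∧ Bk ≠ blk c Ψ) (fun _ h => h.1) ∅
    (by rw [Finset.coe_empty]; exact linearIndepOn_empty _ _) (fun f hf => absurd hf (Finset.notMem_empty f))
  set S₀ : Finset (CMF G c →₀ ℤ) := (Sc ∪ St) ∪ {gface c hc2 (oflipCM c hc2 v (oflipCM c hc2 b X)) u u', gface c hc2 Ψ s t',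
    gface c hc2 (oflipCM c hc2 b X) b v} with hS₀
  have hS₀f : (↑S₀ : Set (CMF G c →₀ ℤ)) ⊆ gfaceSet G c hc2 := by
    intro f hf
    rw [hS₀, coe_union, Set.mem_union] at hf
    rcases hf with hf | hf
    · rw [coe_union, Set.mem_union] at hf
      rcases hf with hf | hf; exacts [hScf hf, hStf hf]
    · simp only [coe_insert, coe_singleton, Set.mem_insert_iff, Set.mem_singleton_iff] at hf
      rcases hf with rfl | rfl | rfl; exacts [hfUp, hfΨ, hf3]
  set L := Submodule.span ℤ (pairSet c) ⊔ Submodule.span ℤ (translates c S₀) with hLdef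
  have hScS : Sc ⊆ S₀ := subset_union_left.trans subset_union_left
  have hStS : St ⊆ S₀ := subset_union_right.trans subset_union_left
  have hUpS : gface c hc2 (oflipCM c hc2 v (oflipCM c hc2 b X)) u u' ∈ S₀ := by rw [hS₀]; exact mem_union_right _ (mem_insert_self _ _)
  have hΨS : gface c hc2 Ψ s t' ∈ S₀ := by rw [hS₀]; exact mem_union_right _ (mem_insert_of_mem (mem_insert_self _ _))
  have h3S : gface c hc2 (oflipCM c hc2 b X) b v ∈ S₀ := by
    rw [hS₀]; exact mem_union_right _ (mem_insert_of_mem (mem_insert_of_mem (mem_singleton_self _)))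
  have hsub : ∀ S' : Finset (CMF G c →₀ ℤ), S' ⊆ S₀ → Submodule.span ℤ (translates c S') ≤ L := fun S' hS' =>
    (Submodule.span_mono fun y hy => by obtain ⟨Q', f, hf, e⟩ := hy; exact ⟨Q', f, hS' hf, e⟩).trans le_sup_right
  have hLQ : ∀ f ∈ S₀, ∀ Q' : G, Finsupp.mapDomain (rt c Q') f ∈ L := fun f hf Q' => Submodule.mem_sup_right (Submodule.subset_span ⟨Q', _, hf, rfl⟩)
  have hL : ∀ f ∈ S₀, f ∈ L := fun f hf => Submodule.mem_sup_right (mem_span_translates_of_mem c S₀ hf)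
  obtain ⟨htwt, hrule⟩ := hSt L (hsub St hStS)
  -- (i) the toward property
  have hd1Ψ : ddist (arcType hw hk hc2 hwc 1) Ψ = (univ.filter fun s : G => w s = 0).card := by
    obtain ⟨-, e1, -, -⟩ := ddist_arcType_four hw hk hk2 hc2 hwc h1 Ψ; omega
  have htw : ∀ Φ : CMF G c, 2 ≤ bpot c (arcType hw hk hc2 hwc 0) Φ → ∃ Q s s' : G, bpot c (arcType hw hk hc2 hwc 0) Φ = ddist (rt c Q (arcType hw hk hc2 hwc 0)) Φ ∧
      s ∈ (rt c Q (arcType hw hk hc2 hwc 0)).1 \ Φ.1 ∧ s' ∈ (rt c Q (arcType hw hk hc2 hwc 0)).1 \ Φ.1 ∧ s ≠ s' ∧ gface c hc2 Φ s s' ∈ L := by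
    refine toward_all_of_on c (arcType hw hk hc2 hwc 0) hc2
      (fun Bk : Block c => 2 ≤ bpot c (arcType hw hk hc2 hwc 0) Bk.out ∧ ¬ tie Bk ∧ Bk ≠ blk c Ψ) _ (fun Φ hΦ => htwc _ (hsub Sc hScS) Φ hΦ) ?_
    intro Φ hΦ hnot
    by_cases htieΦ : tie (blk c Φ)
    · by_cases hE : blk c Φ = E
      · -- the explicit UP face, presented through `T_1 = T_0·Qm⁻¹`
        refine toward_of_explicit c (arcType hw hk hc2 hwc 0) hc2 _ (Q₀ := Qm) (t := c * u) (t' := c * u')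
          (by rw [← eT₁, hpotX'', hd1X'']) (by rw [← eT₁, hT1X'']; exact mem_image_of_mem _ hu) (by rw [← eT₁, hT1X'']; exact mem_image_of_mem _ hu')
          (fun h => huu' (mul_left_cancel h)) (fun Q' => by rw [← hfUpeq]; exact hLQ _ hUpS Q') (hE.trans hEdef)
      · exact htwt Φ htieΦ hE
    · have hblk : blk c Φ = blk c Ψ := by
        by_contra h; exact hnot ⟨by rw [bpot_out]; exact hΦ, htieΦ, h⟩
      refine toward_of_explicit c (arcType hw hk hc2 hwc 0) hc2 _ (Q₀ := Qm) (t := c * s) (t' := t')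
        (by rw [← eT₁, hpotΨ, hd1Ψ]) ?_ ?_ (fun h => by have := congrArg w h; rw [hcs2, ht'1] at this; revert this; subst hk2; decide)
        (fun Q' => by rw [← hfΨeq]; exact hLQ _ hΨS Q') hblk
      · rw [← eT₁]; exact mem_sdiff.mpr ⟨(mem_arcType_iff_of_two hw hk hk2 hc2 hwc 1 _).mpr (Or.inr (by rw [hcs2, n12])), hcsΨ⟩
      · rw [← eT₁]; exact mem_sdiff.mpr ⟨(mem_arcType_iff_of_two hw hk hk2 hc2 hwc 1 _).mpr (Or.inl ht'1), ht'Ψ⟩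
  -- the lower rule on the bottom edge (the `T_0/T_1` instance)
  have htie01 : ∀ Z : CMF G c, blk c Z ≠ E → 2 ≤ bpot c (arcType hw hk hc2 hwc 0) Z →
      bpot c (arcType hw hk hc2 hwc 0) Z < (univ.filter fun s : G => w s = 0).card →
      bpot c (arcType hw hk hc2 hwc 0) Z = ddist (arcType hw hk hc2 hwc 0) Z → bpot c (arcType hw hk hc2 hwc 0) Z = ddist (arcType hw hk hc2 hwc 1) Z →
      ∃ s s' : G, s ∈ (arcType hw hk hc2 hwc 0).1 \ Z.1 ∧ s' ∈ (arcType hw hk hc2 hwc 0).1 \ Z.1 ∧ s ≠ s' ∧ gface c hc2 Z s s' ∈ L := by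
    intro Z hZE h2 hlt hd0 hd1
    have h := hrule Z 1 Qm hZE (by rw [hQm, map_one hw, neg_add_cancel]) h2 hlt (by rwa [rt_one]) (by rwa [← eT₁])
    rwa [rt_one] at h
  -- the excluded block misses the lower-left sub-lattice of `Ψ` (except that it would contain `X_B`)
  have hE : ∀ Z : CMF G c, (arcType hw hk hc2 hwc 0).1 \ Z.1 ⊆ (arcType hw hk hc2 hwc 0).1 \ Ψ.1 →
      ((univ.filter fun s : G => w s = 0) \ Z.1).card = m → blk c Z ≠ E := by
    intro Z hZ hZ0 hblk
    have hdev := sdiff_eq_of_blk_eq_pureTie hw hk hk2 hc2 hwc h1 hm (by omega) (hX''.symm ▸ hCv) (by rw [hX'', hcv]) hBm hVm hZ hZ0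
      (hblk.trans hEdef)
    exact hne (hEdef.symm.trans (hblk.symm.trans (congrArg (blk c) (eq_of_sdiff_eq (hdev.trans hX.symm)))))
  -- (ii) `ζ_b` from the three-across: `X_B` DOWN canonically, `X''` UP by its explicit face
  have hsmall : 2 * (((univ.filter fun s : G => w s = 0) \ Ψ.1).card - 1) < (univ.filter fun s : G => w s = 0).card := by omega
  have hlarge : 2 * ((univ.filter fun s : G => w s = 0).card - ((univ.filter fun s : G => w s = 0) \ Ψ.1).card - 1) <
      (univ.filter fun s : G => w s = 0).card := by omega
  have hX0 : ((univ.filter fun s : G => w s = 0) \ X.1).card = m := by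
    rw [fib_zero_sdiff_eq_filter hw hk hk2 hc2 hwc, hX, filter_true_of_mem fun x hx => (mem_filter.mp (hBF hx)).2, hBm]
  have hX1 : ((univ.filter fun s : G => w s = 1) \ X.1).card = 0 := by
    rw [fib_one_sdiff_eq_filter hw hk hk2 hc2 hwc, hX, card_eq_zero, filter_eq_empty_iff]
    intro x hx h; have := (mem_filter.mp (hBF hx)).2; rw [this] at h; exact one_ne_zero h.symm
  have hEX : ∀ Z : CMF G c, (arcType hw hk hc2 hwc 0).1 \ Z.1 ⊆ (arcType hw hk hc2 hwc 0).1 \ X.1 →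
      ((univ.filter fun s : G => w s = 0) \ Z.1).card = m → blk c Z ≠ E := by
    intro Z hZ
    refine hE Z (hZ.trans ?_)
    rw [hX, fib_zero_sdiff_eq_filter hw hk hk2 hc2 hwc]; exact filter_subset _ _
  have eDn := single_sub_normalForm_mem_of_lowerLeft hw hk hk2 hc2 hwc h1 L htw hm _ htie01 X hX0.le (by omega) hEX
  have eUp := single_sub_normalForm_mem_of_face hw hk hc2 hwc L htw Qm (Φ := oflipCM c hc2 v (oflipCM c hc2 b X))
    (by rw [← eT₁, hd1X'']; omega) (by rw [← eT₁, hT1X'']; exact mem_image_of_mem _ hu) (by rw [← eT₁, hT1X'']; exact mem_image_of_mem _ hu')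
    (fun h => huu' (mul_left_cancel h)) (by rw [← hfUpeq]; exact hL _ hUpS)
  rw [← eT₁] at eUp
  have hζb := zeta_mem_of_threeAcross_even_up hw hk hc2 hwc h1 L htw hb hX' hBF hsmall hlarge hv0 hvB (hL _ h3S) (by rw [hX'b]; exact eDn) eUp
  -- (iii) the relation of the owned face
  have hshift1 : ∀ u : G, w u = 1 →
      Finsupp.single (oflipCM c hc2 u (arcType hw hk hc2 hwc 0)) (1 : ℤ) - Finsupp.single (arcType hw hk hc2 hwc 0) 1 -
          Finsupp.single (oflipCM c hc2 u (arcType hw hk hc2 hwc 1)) 1 + Finsupp.single (arcType hw hk hc2 hwc 1) 1 ∈ L := by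
    intro u hu
    have h := shift_mem_of_zeta_mem hw hk hk2 hc2 hcen hwc S₀ hb0 hu hζb
    rwa [hu] at h
  have hR := rel_of_balancedFace hw hk hk2 hc2 hcen hwc h1 hm S₀ htw _ htie01 hΨ hg hE hs0 hsΨ ht'1 ht'Ψ (hL _ hΨS) hshift1
  obtain ⟨hst0, -⟩ := st_spec hw hk hk2 hc2 hwc hΨ hg ht'1 ht'Ψ
  refine ⟨S₀, hS₀f, ?_, htw, ⟨b, hb0, hζb⟩, ⟨_, insert_subset (mem_filter.mpr ⟨mem_univ _, hst0⟩) hBF, hR⟩⟩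
  -- the count `|S₀| + 2 ≤ β`
  obtain ⟨n₀, n₁, hn₀1, hn₁1, hn₀₁, hn₀, hn₁⟩ := exists_two_ker hw (by omega)
  have hnear := half_add_one_le_card_filter_bpot_le_one' hw hk hc2 hcen hwc h1 hn₀1 hn₁1 hn₀₁ hn₀ hn₁
  rw [show 2 ^ (k - 1) = 2 by subst hk2; rfl] at hnear
  have hsplit := card_filter_add_card_filter_not (s := (univ : Finset (Block c))) (fun Bk : Block c => 2 ≤ bpot c (arcType hw hk hc2 hwc 0) Bk.out)
  have hneg : (univ.filter fun Bk : Block c => ¬ 2 ≤ bpot c (arcType hw hk hc2 hwc 0) Bk.out) = univ.filter fun Bk : Block c => bpot c (arcType hw hk hc2 hwc 0) Bk.out ≤ 1 :=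
    filter_congr fun Bk _ => by omega
  rw [hneg, card_univ] at hsplit
  -- the far blocks split into tie blocks and non-tie blocks; `blk Ψ` is a non-tie far block outside the cover set
  have hsplit2 := card_filter_add_card_filter_not (s := univ.filter fun Bk : Block c => 2 ≤ bpot c (arcType hw hk hc2 hwc 0) Bk.out) tie
  have htiesub : (univ.filter fun Bk : Block c => tie Bk) ⊆ (univ.filter fun Bk : Block c => 2 ≤ bpot c (arcType hw hk hc2 hwc 0) Bk.out).filter tie := by
    intro Bk hBk; rw [mem_filter] at hBk ⊢; exact ⟨mem_filter.mpr ⟨mem_univ _, ((htie Bk).mp hBk.2).1⟩, hBk.2⟩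
  have hΨfar : blk c Ψ ∈ (univ.filter fun Bk : Block c => 2 ≤ bpot c (arcType hw hk hc2 hwc 0) Bk.out).filter (fun Bk => ¬ tie Bk) := by
    rw [mem_filter, mem_filter, bpot_out, hpotΨ]
    refine ⟨⟨mem_univ _, by omega⟩, fun h => ?_⟩
    have := ((htie _).mp h).2.1; rw [bpot_out, hpotΨ] at this; exact lt_irrefl _ this
  have hgen_sub : insert (blk c Ψ) (univ.filter fun Bk : Block c => 2 ≤ bpot c (arcType hw hk hc2 hwc 0) Bk.out ∧ ¬ tie Bk ∧ Bk ≠ blk c Ψ) ⊆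
      (univ.filter fun Bk : Block c => 2 ≤ bpot c (arcType hw hk hc2 hwc 0) Bk.out).filter (fun Bk => ¬ tie Bk) := by
    refine insert_subset hΨfar fun Bk hBk => ?_
    rw [mem_filter] at hBk; rw [mem_filter, mem_filter]; exact ⟨⟨mem_univ _, hBk.2.1⟩, hBk.2.2.1⟩
  have hΨnot : blk c Ψ ∉ univ.filter fun Bk : Block c => 2 ≤ bpot c (arcType hw hk hc2 hwc 0) Bk.out ∧ ¬ tie Bk ∧ Bk ≠ blk c Ψ := by
    rw [mem_filter]; exact fun h => h.2.2.2 rfl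
  have hgen_card := card_le_card hgen_sub
  rw [card_insert_of_notMem hΨnot] at hgen_card
  -- `E = blk X''` is a tie block
  have hEtie : tie E := by
    obtain ⟨P, hP⟩ := exists_rt_eq_of_blk_eq c ((blk_out c E).trans hEdef)
    have hinv : rt c P⁻¹ (oflipCM c hc2 v (oflipCM c hc2 b X)) = E.out := by rw [← hP, rt_inv_rt]
    have hpot : bpot c (arcType hw hk hc2 hwc 0) E.out = m := by rw [← hinv, bpot_rt, hpotX'']
    have hd0 : bpot c (arcType hw hk hc2 hwc 0) (oflipCM c hc2 v (oflipCM c hc2 b X)) =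
        ddist (rt c 1 (arcType hw hk hc2 hwc 0)) (oflipCM c hc2 v (oflipCM c hc2 b X)) := by
      rw [rt_one, bpot_eq_of_tie hw hk hc2 hwc h2X'']; rfl
    have hd1 : bpot c (arcType hw hk hc2 hwc 0) (oflipCM c hc2 v (oflipCM c hc2 b X)) =
        ddist (rt c Qm (arcType hw hk hc2 hwc 0)) (oflipCM c hc2 v (oflipCM c hc2 b X)) := by
      rw [← eT₁, hpotX'', hd1X'']
    have hdat := tieDatum_rt hw hk hc2 hwc P⁻¹ (Q := 1) (Q' := Qm) (by rw [hQm, map_one hw, neg_add_cancel]) hd0 hd1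
    rw [hinv] at hdat
    exact (htie E).mpr ⟨by rw [hpot]; exact hm2, by rw [hpot]; exact hmn, _, _, hdat.1, hdat.2.1, hdat.2.2⟩
  have hEmem : E ∈ univ.filter fun Bk : Block c => tie Bk := mem_filter.mpr ⟨mem_univ _, hEtie⟩
  have htieE : (univ.filter fun Bk : Block c => tie Bk ∧ Bk ≠ E) =
      (univ.filter fun Bk : Block c => tie Bk).erase E := by
    ext Bk; simp only [mem_filter, mem_univ, true_and, mem_erase]; tauto
  have htiec := card_erase_add_one hEmem
  rw [← htieE] at htiec
  have htiesub' := card_le_card htiesub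
  have h3 : ({gface c hc2 (oflipCM c hc2 v (oflipCM c hc2 b X)) u u', gface c hc2 Ψ s t', gface c hc2 (oflipCM c hc2 b X) b v} :
      Finset (CMF G c →₀ ℤ)).card ≤ 3 := card_le_three
  have hun := card_union_le (Sc ∪ St) ({gface c hc2 (oflipCM c hc2 v (oflipCM c hc2 b X)) u u', gface c hc2 Ψ s t', gface c hc2 (oflipCM c hc2 b X) b v} :
      Finset (CMF G c →₀ ℤ))
  have hun2 := card_union_le Sc St
  rw [← hS₀] at hun
  rw [hScc] at hun2
  omega

end

end Summit.HodgeConjecture.CorCM.Census.CyclicCharacter
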